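import Mathlib

/-!
# Weak limits of probability measures with a uniform exponential moment

Support file for item `DilutionTransfer` (stmt-CriticalPhenomena-6037) of route
`HarmonicMomentsIsotropy` (sub-problem `Ising3DConformalLimit`).

For a sequence of Borel probability measures `μ_j` on a finite-dimensional real normed space with
`∫ e^{c‖y‖} dμ_j ≤ K` (`c > 0`):
* `measure_norm_gt_le_of_exp_moment` — Chernoff tail bound `μ_j{‖y‖ > r} ≤ K e^{-cr}`;
* `exists_subseq_tendsto_of_exp_moment` — a subsequence converges weakly (tightness + Prokhorov,
  Mathlib's `isCompact_closure_of_isTightMeasureSet`);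
* `exp_moment_le_of_tendsto` — the weak limit has the same exponential moment bound;
* `tendsto_integral_of_sq_le_exp_moment` — along a weakly convergent sequence, `∫ g dμ_j → ∫ g dμ`
  for every continuous `g` with `g² ≤ A e^{c‖y‖}` (uniform integrability by truncation).

References: P. Billingsley, *Convergence of Probability Measures* (2nd ed.), Thm. 5.1 (Prokhorov) and
Thm. 3.5 (uniform integrability); the proofs here are self-contained on top of Mathlib.
-/

noncomputable section

open MeasureTheory Filter Topology Set BoundedContinuousFunction
open scoped ENNReal NNReal

namespace Summit.CriticalPhenomena.Ising3DConformalLimit.Theorems.HarmonicMomentsIsotropy.WeakLimit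

variable {E : Type*} [NormedAddCommGroup E] [NormedSpace ℝ E] [FiniteDimensional ℝ E]
  [MeasurableSpace E] [BorelSpace E]

/-! ## Tail bound and tightness -/

omit [NormedSpace ℝ E] [FiniteDimensional ℝ E] [BorelSpace E] in
/-- **Chernoff tail bound**: `μ{‖y‖ > r} ≤ K e^{-cr}` when `∫ e^{c‖y‖} dμ ≤ K`, `c > 0`. -/
theorem measure_norm_gt_le_of_exp_moment [OpensMeasurableSpace E] {μ : Measure E} {c K : ℝ}
    (hc : 0 < c) (hint : Integrable (fun y => Real.exp (c * ‖y‖)) μ)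
    (hK : ∫ y, Real.exp (c * ‖y‖) ∂μ ≤ K) (r : ℝ) :
    μ {y | r < ‖y‖} ≤ ENNReal.ofReal (K * Real.exp (-(c * r))) := by
  have hmarkov := mul_meas_ge_le_lintegral₀ (μ := μ)
    (f := fun y => ENNReal.ofReal (Real.exp (c * ‖y‖)))
    (hint.aemeasurable.ennreal_ofReal) (ENNReal.ofReal (Real.exp (c * r)))
  have hsub : {y : E | r < ‖y‖} ⊆ {y | ENNReal.ofReal (Real.exp (c * r)) ≤
      ENNReal.ofReal (Real.exp (c * ‖y‖))} := by
    intro y hy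
    simp only [mem_setOf_eq] at hy ⊢
    exact ENNReal.ofReal_le_ofReal (Real.exp_le_exp.2 (by nlinarith))
  have hlint : ∫⁻ y, ENNReal.ofReal (Real.exp (c * ‖y‖)) ∂μ ≤ ENNReal.ofReal K := by
    rw [← ofReal_integral_eq_lintegral_ofReal hint (ae_of_all _ fun y => (Real.exp_pos _).le)]
    exact ENNReal.ofReal_le_ofReal hK
  have hpos : ENNReal.ofReal (Real.exp (c * r)) ≠ 0 := by
    simp [Real.exp_pos]
  calc μ {y | r < ‖y‖} ≤ μ {y | ENNReal.ofReal (Real.exp (c * r)) ≤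
        ENNReal.ofReal (Real.exp (c * ‖y‖))} := measure_mono hsub
    _ ≤ (∫⁻ y, ENNReal.ofReal (Real.exp (c * ‖y‖)) ∂μ) / ENNReal.ofReal (Real.exp (c * r)) := by
        rw [ENNReal.le_div_iff_mul_le (Or.inl hpos) (Or.inl ENNReal.ofReal_ne_top), mul_comm]
        exact hmarkov
    _ ≤ ENNReal.ofReal K / ENNReal.ofReal (Real.exp (c * r)) := ENNReal.div_le_div_right hlint _
    _ = ENNReal.ofReal (K * Real.exp (-(c * r))) := by
        rw [Real.exp_neg, ← div_eq_mul_inv, ENNReal.ofReal_div_of_pos (Real.exp_pos _)]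

/-- A family of probability measures with a uniform exponential moment is tight. -/
theorem isTightMeasureSet_of_exp_moment {ι : Type*} {μs : ι → ProbabilityMeasure E} {c K : ℝ}
    (hc : 0 < c) (hint : ∀ i, Integrable (fun y => Real.exp (c * ‖y‖)) (μs i : Measure E))
    (hK : ∀ i, ∫ y, Real.exp (c * ‖y‖) ∂(μs i : Measure E) ≤ K) :
    IsTightMeasureSet {((μ : ProbabilityMeasure E) : Measure E) | μ ∈ Set.range μs} := by
  rw [isTightMeasureSet_iff_tendsto_measure_norm_gt]
  have hup : Tendsto (fun r : ℝ => ENNReal.ofReal (K * Real.exp (-(c * r)))) atTop (𝓝 0) := by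
    rw [← ENNReal.ofReal_zero]
    refine ENNReal.tendsto_ofReal ?_
    have h1 : Tendsto (fun r : ℝ => Real.exp (-(c * r))) atTop (𝓝 0) := by
      have := Real.tendsto_exp_neg_atTop_nhds_zero.comp (tendsto_id.const_mul_atTop hc)
      exact this
    simpa using h1.const_mul K
  refine tendsto_of_tendsto_of_tendsto_of_le_of_le tendsto_const_nhds hup
    (fun r => bot_le) (fun r => ?_)
  simp only
  refine iSup₂_le fun μ hμ => ?_
  obtain ⟨ν, ⟨i, rfl⟩, rfl⟩ := hμ
  exact measure_norm_gt_le_of_exp_moment hc (hint i) (hK i) r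

/-- **Prokhorov**: a sequence of probability measures with a uniform exponential moment has a
weakly convergent subsequence. -/
theorem exists_subseq_tendsto_of_exp_moment {μs : ℕ → ProbabilityMeasure E} {c K : ℝ}
    (hc : 0 < c) (hint : ∀ j, Integrable (fun y => Real.exp (c * ‖y‖)) (μs j : Measure E))
    (hK : ∀ j, ∫ y, Real.exp (c * ‖y‖) ∂(μs j : Measure E) ≤ K) :
    ∃ μ : ProbabilityMeasure E, ∃ φ : ℕ → ℕ, StrictMono φ ∧ Tendsto (μs ∘ φ) atTop (𝓝 μ) := by
  have htight := isTightMeasureSet_of_exp_moment hc hint hK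
  have hcomp : IsCompact (closure (Set.range μs)) :=
    isCompact_closure_of_isTightMeasureSet (S := Set.range μs) htight
  obtain ⟨μ, -, φ, hφ, hlim⟩ := hcomp.tendsto_subseq (x := μs) fun n => subset_closure ⟨n, rfl⟩
  exact ⟨μ, φ, hφ, hlim⟩

/-! ## The exponential moment passes to the limit -/

omit [NormedSpace ℝ E] [FiniteDimensional ℝ E] [MeasurableSpace E] [BorelSpace E] in
/-- The truncations `y ↦ min (e^{c‖y‖}) N` as bounded continuous functions. -/
theorem exists_bcf_min_exp (c : ℝ) (N : ℝ) (hN : 0 ≤ N) :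
    ∃ f : E →ᵇ ℝ, ∀ y, f y = min (Real.exp (c * ‖y‖)) N := by
  refine ⟨BoundedContinuousFunction.ofNormedAddCommGroup (fun y => min (Real.exp (c * ‖y‖)) N)
    (by fun_prop) N (fun y => ?_), fun y => rfl⟩
  rw [Real.norm_eq_abs, abs_of_nonneg (le_min (Real.exp_pos _).le hN)]
  exact min_le_right _ _

omit [NormedSpace ℝ E] [FiniteDimensional ℝ E] in
/-- **The weak limit inherits the exponential moment bound.** -/
theorem exp_moment_le_of_tendsto {μs : ℕ → ProbabilityMeasure E} {μ : ProbabilityMeasure E}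
    {c K : ℝ} (hlim : Tendsto μs atTop (𝓝 μ))
    (hint : ∀ j, Integrable (fun y => Real.exp (c * ‖y‖)) (μs j : Measure E))
    (hK : ∀ j, ∫ y, Real.exp (c * ‖y‖) ∂(μs j : Measure E) ≤ K) :
    Integrable (fun y => Real.exp (c * ‖y‖)) (μ : Measure E) ∧
      ∫ y, Real.exp (c * ‖y‖) ∂(μ : Measure E) ≤ K := by
  have hK0 : 0 ≤ K := le_trans (integral_nonneg fun y => (Real.exp_pos _).le) (hK 0)
  -- the truncated integrals of the limit are `≤ K`
  have htrunc : ∀ N : ℕ, ∫ y, min (Real.exp (c * ‖y‖)) (N : ℝ) ∂(μ : Measure E) ≤ K := by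
    intro N
    obtain ⟨f, hf⟩ := exists_bcf_min_exp (E := E) c N N.cast_nonneg
    have hconv := (ProbabilityMeasure.tendsto_iff_forall_integral_tendsto.1 hlim) f
    simp only [hf] at hconv
    refine le_of_tendsto' hconv fun j => ?_
    calc ∫ y, min (Real.exp (c * ‖y‖)) (N : ℝ) ∂(μs j : Measure E)
        ≤ ∫ y, Real.exp (c * ‖y‖) ∂(μs j : Measure E) := by
          refine integral_mono_of_nonneg (ae_of_all _ fun y => le_min (Real.exp_pos _).le
            N.cast_nonneg) (hint j) (ae_of_all _ fun y => min_le_left _ _)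
      _ ≤ K := hK j
  -- monotone convergence
  have hmeas : Measurable fun y : E => Real.exp (c * ‖y‖) := by fun_prop
  have hlint : ∫⁻ y, ENNReal.ofReal (Real.exp (c * ‖y‖)) ∂(μ : Measure E) ≤ ENNReal.ofReal K := by
    have hsup : ∀ y : E, ENNReal.ofReal (Real.exp (c * ‖y‖)) =
        ⨆ N : ℕ, ENNReal.ofReal (min (Real.exp (c * ‖y‖)) (N : ℝ)) := by
      intro y
      apply le_antisymm
      · obtain ⟨N, hN⟩ := exists_nat_ge (Real.exp (c * ‖y‖))
        exact le_iSup_of_le N (by rw [min_eq_left hN])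
      · exact iSup_le fun N => ENNReal.ofReal_le_ofReal (min_le_left _ _)
    simp_rw [hsup]
    rw [lintegral_iSup (fun N => (hmeas.min measurable_const).ennreal_ofReal) ?_]
    · refine iSup_le fun N => ?_
      rw [← ofReal_integral_eq_lintegral_ofReal]
      · exact ENNReal.ofReal_le_ofReal (htrunc N)
      · exact (integrable_const (N : ℝ)).mono' (hmeas.min measurable_const).aestronglyMeasurable
          (ae_of_all _ fun y => by
            rw [Real.norm_eq_abs, abs_of_nonneg (le_min (Real.exp_pos _).le N.cast_nonneg)]
            exact min_le_right _ _)
      · exact ae_of_all _ fun y => le_min (Real.exp_pos _).le N.cast_nonneg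
    · intro N M hNM y
      exact ENNReal.ofReal_le_ofReal (min_le_min_left _ (by exact_mod_cast hNM))
  have hintμ : Integrable (fun y => Real.exp (c * ‖y‖)) (μ : Measure E) := by
    refine ⟨hmeas.aestronglyMeasurable, ?_⟩
    rw [hasFiniteIntegral_iff_norm]
    calc ∫⁻ y, ENNReal.ofReal ‖Real.exp (c * ‖y‖)‖ ∂(μ : Measure E)
        = ∫⁻ y, ENNReal.ofReal (Real.exp (c * ‖y‖)) ∂(μ : Measure E) := by
          refine lintegral_congr fun y => ?_
          rw [Real.norm_eq_abs, abs_of_pos (Real.exp_pos _)]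
      _ ≤ ENNReal.ofReal K := hlint
      _ < ⊤ := ENNReal.ofReal_lt_top
  refine ⟨hintμ, ?_⟩
  rw [integral_eq_lintegral_of_nonneg_ae (ae_of_all _ fun y => (Real.exp_pos _).le)
    hmeas.aestronglyMeasurable]
  exact ENNReal.toReal_le_of_le_ofReal hK0 hlint

/-! ## Convergence of integrals of functions with `g² ≤ A e^{c‖y‖}` -/

/-- Truncation error: `|x - clamp_N x| ≤ x²/N`. -/
theorem abs_sub_clamp_le (x : ℝ) {N : ℝ} (hN : 0 < N) :
    |x - max (-N) (min x N)| ≤ x ^ 2 / N := by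
  rw [le_div_iff₀ hN]
  rcases le_or_gt x N with hxN | hxN
  · rw [min_eq_left hxN]
    rcases le_or_gt (-N) x with hNx | hNx
    · rw [max_eq_right hNx, sub_self, abs_zero, zero_mul]; positivity
    · rw [max_eq_left hNx.le]
      rw [abs_of_nonpos (by linarith)]
      nlinarith
  · rw [min_eq_right hxN.le, max_eq_right (by linarith), abs_of_nonneg (by linarith)]
    nlinarith

omit [NormedSpace ℝ E] [FiniteDimensional ℝ E] in
/-- For a measure with `∫ e^{c‖y‖} ≤ K` and a continuous `g` with `g² ≤ A e^{c‖y‖}`: `g` is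
integrable and the truncation error is `≤ A K / N`. -/
theorem integral_sub_clamp_le {μ : Measure E} [IsFiniteMeasure μ] {c K A : ℝ} {g : E → ℝ}
    (hg : Continuous g) (hA : ∀ y, g y ^ 2 ≤ A * Real.exp (c * ‖y‖))
    (hint : Integrable (fun y => Real.exp (c * ‖y‖)) μ) (hK : ∫ y, Real.exp (c * ‖y‖) ∂μ ≤ K)
    {N : ℝ} (hN : 0 < N) :
    Integrable g μ ∧ |∫ y, g y ∂μ - ∫ y, max (-N) (min (g y) N) ∂μ| ≤ A * K / N := by
  have hA0 : 0 ≤ A := by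
    have h := hA 0
    have he : 0 < Real.exp (c * ‖(0 : E)‖) := Real.exp_pos _
    nlinarith [sq_nonneg (g 0)]
  have hg2 : Integrable (fun y => g y ^ 2) μ :=
    (hint.const_mul A).mono' (by fun_prop) (ae_of_all _ fun y => by
      rw [Real.norm_eq_abs, abs_of_nonneg (sq_nonneg _)]; exact hA y)
  have hgint : Integrable g μ := by
    refine ((integrable_const (1 : ℝ)).add hg2).mono' hg.aestronglyMeasurable
      (ae_of_all _ fun y => ?_)
    rw [Real.norm_eq_abs, Pi.add_apply]
    nlinarith [abs_nonneg (g y), sq_abs (g y), sq_nonneg (|g y| - 1)]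
  have hclamp : Integrable (fun y => max (-N) (min (g y) N)) μ := by
    refine (integrable_const N).mono' (by fun_prop) (ae_of_all _ fun y => ?_)
    rw [Real.norm_eq_abs]
    exact abs_le.2 ⟨by simp, max_le (by linarith) (min_le_right _ _)⟩
  refine ⟨hgint, ?_⟩
  rw [← integral_sub hgint hclamp]
  calc |∫ y, (g y - max (-N) (min (g y) N)) ∂μ|
      ≤ ∫ y, |g y - max (-N) (min (g y) N)| ∂μ := abs_integral_le_integral_abs
    _ ≤ ∫ y, g y ^ 2 / N ∂μ := by
        refine integral_mono_of_nonneg (ae_of_all _ fun y => abs_nonneg _) (hg2.div_const N)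
          (ae_of_all _ fun y => abs_sub_clamp_le (g y) hN)
    _ ≤ ∫ y, A * Real.exp (c * ‖y‖) / N ∂μ := by
        refine integral_mono (hg2.div_const N) ((hint.const_mul A).div_const N) fun y => ?_
        exact div_le_div_of_nonneg_right (hA y) hN.le
    _ = A / N * ∫ y, Real.exp (c * ‖y‖) ∂μ := by
        rw [← integral_const_mul]
        refine integral_congr_ae (ae_of_all _ fun y => ?_)
        simp only; ring
    _ ≤ A / N * K := mul_le_mul_of_nonneg_left hK (by positivity)
    _ = A * K / N := by ring

omit [NormedSpace ℝ E] [FiniteDimensional ℝ E] in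
/-- **Moment convergence under a uniform exponential moment.** If `μ_j → μ` weakly, all `μ_j` and
`μ` satisfy `∫ e^{c‖y‖} ≤ K`, and `g` is continuous with `g² ≤ A e^{c‖y‖}`, then
`∫ g dμ_j → ∫ g dμ`. -/
theorem tendsto_integral_of_sq_le_exp_moment {μs : ℕ → ProbabilityMeasure E}
    {μ : ProbabilityMeasure E} {c K A : ℝ} {g : E → ℝ} (hlim : Tendsto μs atTop (𝓝 μ))
    (hg : Continuous g) (hA : ∀ y, g y ^ 2 ≤ A * Real.exp (c * ‖y‖))
    (hint : ∀ j, Integrable (fun y => Real.exp (c * ‖y‖)) (μs j : Measure E))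
    (hK : ∀ j, ∫ y, Real.exp (c * ‖y‖) ∂(μs j : Measure E) ≤ K)
    (hintμ : Integrable (fun y => Real.exp (c * ‖y‖)) (μ : Measure E))
    (hKμ : ∫ y, Real.exp (c * ‖y‖) ∂(μ : Measure E) ≤ K) :
    Tendsto (fun j => ∫ y, g y ∂(μs j : Measure E)) atTop (𝓝 (∫ y, g y ∂(μ : Measure E))) := by
  have hA0 : 0 ≤ A := by
    have h := hA 0
    have he : 0 < Real.exp (c * ‖(0 : E)‖) := Real.exp_pos _
    nlinarith [sq_nonneg (g 0)]
  have hK0 : 0 ≤ K := le_trans (integral_nonneg fun y => (Real.exp_pos _).le) (hK 0)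
  rw [Metric.tendsto_atTop]
  intro ε hε
  -- choose the truncation level
  obtain ⟨N, hN⟩ : ∃ N : ℝ, 0 < N ∧ A * K / N < ε / 4 := by
    refine ⟨4 * (A * K + 1) / ε, by positivity, ?_⟩
    rw [div_lt_iff₀ (by positivity)]
    have : A * K < (A * K + 1) := by linarith
    calc A * K < A * K + 1 := this
      _ = ε / 4 * (4 * (A * K + 1) / ε) := by field_simp
  -- the truncation as a bounded continuous function
  set gN : E →ᵇ ℝ := BoundedContinuousFunction.ofNormedAddCommGroup
    (fun y => max (-N) (min (g y) N)) (by fun_prop) N (fun y => by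
      rw [Real.norm_eq_abs]
      exact abs_le.2 ⟨by simp, max_le (by linarith) (min_le_right _ _)⟩) with hgN
  have hgN_apply : ∀ y, gN y = max (-N) (min (g y) N) := fun y => rfl
  have hconv := (ProbabilityMeasure.tendsto_iff_forall_integral_tendsto.1 hlim) gN
  rw [Metric.tendsto_atTop] at hconv
  obtain ⟨J, hJ⟩ := hconv (ε / 2) (half_pos hε)
  refine ⟨J, fun j hj => ?_⟩
  have h1 := (integral_sub_clamp_le hg hA (hint j) (hK j) hN.1).2
  have h2 := (integral_sub_clamp_le hg hA hintμ hKμ hN.1).2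
  have h3 := hJ j hj
  rw [Real.dist_eq] at h3 ⊢
  simp only [hgN_apply] at h3
  set a := ∫ y, g y ∂(μs j : Measure E) with ha
  set b := ∫ y, g y ∂(μ : Measure E) with hb
  set aN := ∫ y, max (-N) (min (g y) N) ∂(μs j : Measure E) with haN
  set bN := ∫ y, max (-N) (min (g y) N) ∂(μ : Measure E) with hbN
  have key : |a - b| ≤ |a - aN| + |aN - bN| + |b - bN| := by
    have e : a - b = (a - aN) + (aN - bN) - (b - bN) := by ring
    rw [e]
    calc |(a - aN) + (aN - bN) - (b - bN)| ≤ |(a - aN) + (aN - bN)| + |b - bN| := abs_sub _ _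
      _ ≤ |a - aN| + |aN - bN| + |b - bN| := by gcongr; exact abs_add_le _ _
  linarith [hN.2, key, h1, h2, h3]

end Summit.CriticalPhenomena.Ising3DConformalLimit.Theorems.HarmonicMomentsIsotropy.WeakLimit

end
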